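import Summits.QuantumFields.QCD.Theorems.NestedDissectionSeaCoerciveSeaPropagatorForm
import Summits.QuantumFields.QCD.Theorems.NestedDissectionSeaCoerciveSeaCensusDominates

/-!
# Crux `CoerciveSea` (stmt-QuantumFields-13901) — clause (i) on large boxes in PROPAGATOR currency:
# a weak-type (Wegner) law for the separator-compressed cell propagator implies the line's open stub

Helper file of line lead c4, line `chirality-collapses-pseudospectrum`. The one open internal stub of the line's skeleton
(v8–v10), `stub_separatorLawLarge`, asks on large window boxes along every physical-branch pinned-dilute regularisation
the crux's own event `HasSingularSeparator U m_f(k) s (t/s₀)` with phase-quenched probability `≤ C t^α`. By the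
PROPAGATOR FORM (`hasSingularSeparator_imp_det_eq_zero_or_compressedInverse`, `…PropagatorForm.lean`) that event is
contained in

  `F_τ(U) : det D_c(μ) = 0 ∨ ∃ v ≠ 0 on Σ, ‖v‖² < τ² ‖(D_c(μ)⁻¹)_ΣΣ v‖²` (`τ = t/s₀`, `μ = m_f(k)`),

"the cell has a zero mode at the valence mass, or its propagator compressed to the internal separator has norm `> s₀/t`".
This file proves (1) `F_τ` is a MEASURABLE event of the gauge field (registered stub `measurableSet_compressedInverseEvent`:
`{det = 0}` is closed; off it, clearing the determinant turns the propagator condition into the OPEN adjugate condition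
`‖det D_c‖² ‖v‖² < τ² ‖(adj D_c)_ΣΣ v‖²`, an open projection), (2) monotonicity of the phase-quenched ratio under a
measurable cover (`ratio_mono`, from `CensusDominates.ratio_le`), and (3) the reduction
`separatorLawLarge_of_propagatorLaw`: the same law with `F_{t/s₀}` in place of the crux's event — a `k`-UNIFORM WEAK-TYPE
(WEGNER) ESTIMATE FOR THE SURFACE-COMPRESSED GREEN'S FUNCTION of near-critical Dirichlet Wilson–Dirac cells under the
interacting phase-quenched `SU(3)` measure — implies `stub_separatorLawLarge` VERBATIM. This is the currency in which
multiscale analysis (Fröhlich–Spencer 1983: decay/size of `1_∂Λ G_Λ`) and fractional-moment methods (Aizenman–Molchanov)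
produce Wegner-type bounds; no such estimate exists for a gauge-covariant hopping disorder under a Gibbs law, uniformly
along a continuum limit — the open content of the crux (`FINDINGS-lead-c3.md` §5, `FINDINGS-lead-c4.md`). [folklore]
-/

noncomputable section

open scoped BigOperators Classical
open MeasureTheory Filter Matrix
open Literature.MathematicalPhysics.QuantumLattice Literature.MathematicalPhysics.QuantumFieldTheory
  Literature.Probability.LatticeModels

namespace Summit.QuantumFields.QCD.Theorems.NestedDissectionSeaCoerciveSea

/-- Local notation: the colour group `SU(3)`. -/
local notation "𝔾" => Matrix.specialUnitaryGroup (Fin 3) ℂ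

/-! ### Block algebra: compressed inverse = `det⁻¹ •` compressed adjugate -/

section Generic

variable {m : Type*} [Fintype m] [DecidableEq m]

omit [Fintype m] [DecidableEq m] in
/-- `toBlock` commutes with scalar multiplication. [folklore] -/
theorem toBlock_smul' (c : ℂ) (M : Matrix m m ℂ) (p q : m → Prop) :
    (c • M).toBlock p q = c • M.toBlock p q := by
  ext i j
  simp only [Matrix.toBlock_apply, Matrix.smul_apply]

/-- The compressed inverse acts as `det⁻¹ •` the compressed adjugate (for ANY square complex matrix: both sides vanish
when `det = 0`, Mathlib's junk inverse). [folklore] -/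
theorem toBlock_inv_mulVec (M : Matrix m m ℂ) (p : m → Prop) [DecidablePred p] (v : {a // p a} → ℂ) :
    (M⁻¹.toBlock p p) *ᵥ v = (M.det)⁻¹ • ((M.adjugate.toBlock p p) *ᵥ v) := by
  rw [Matrix.inv_def, Ring.inverse_eq_inv', toBlock_smul', Matrix.smul_mulVec]

/-- Squared-norm sum of a scalar multiple. [folklore] -/
theorem sum_norm_smul_sq {ι : Type*} [Fintype ι] (c : ℂ) (w : ι → ℂ) :
    ∑ i, ‖(c • w) i‖ ^ 2 = ‖c‖ ^ 2 * ∑ i, ‖w i‖ ^ 2 := by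
  rw [Finset.mul_sum]
  exact Finset.sum_congr rfl fun i _ => by rw [Pi.smul_apply, smul_eq_mul, norm_mul, mul_pow]

/-- **Clearing the determinant.** For `det M ≠ 0` the propagator condition `‖v‖² < τ² ‖(M⁻¹)_pp v‖²` is the adjugate
condition `‖det M‖² ‖v‖² < τ² ‖(adj M)_pp v‖²`. [folklore] -/
theorem compressedInverse_lt_iff_adjugate (M : Matrix m m ℂ) (p : m → Prop) [DecidablePred p] (hdet : M.det ≠ 0)
    (τ : ℝ) (v : {a // p a} → ℂ) :
    (∑ q, ‖v q‖ ^ 2 < τ ^ 2 * ∑ q, ‖((M⁻¹.toBlock p p) *ᵥ v) q‖ ^ 2) ↔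
      ‖M.det‖ ^ 2 * ∑ q, ‖v q‖ ^ 2 < τ ^ 2 * ∑ q, ‖((M.adjugate.toBlock p p) *ᵥ v) q‖ ^ 2 := by
  have hd : 0 < ‖M.det‖ ^ 2 := pow_pos (norm_pos_iff.mpr hdet) 2
  rw [toBlock_inv_mulVec, sum_norm_smul_sq, norm_inv, inv_pow, ← mul_assoc, mul_comm (τ ^ 2), mul_assoc,
    ← div_eq_inv_mul, lt_div_iff₀ hd, mul_comm]

end Generic

/-! ### (1) Measurability of the propagator event -/

/-- The Dirichlet cell determinant is a continuous function of the gauge field. [folklore] -/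
theorem continuous_det_wilsonCell {N : ℕ} [NeZero N] (μ : ℝ) (s : Fin 4 → ℕ) :
    Continuous fun U : GaugeConfig 4 N 𝔾 => (wilsonCell U μ 0 s).det :=
  (Summit.QuantumFields.QCD.Cruxes.CoerciveSea.ChiralityCollapsesPseudospectrum.CensusDominates.continuous_wilsonCell
    μ 0 s).matrix_det

/-- The ADJUGATE form of the propagator event is OPEN in (field, separator vector): `v ≠ 0` and
`‖det D_c‖² ‖v‖² < τ² ‖(adj D_c)_ΣΣ v‖²` are strict conditions on continuous functions (the adjugate is polynomial).
[folklore] -/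
theorem isOpen_adjugateEvent {N : ℕ} [NeZero N] (μ : ℝ) (s : Fin 4 → ℕ) (τ : ℝ) :
    IsOpen {x : GaugeConfig 4 N 𝔾 × ({p : {p // wilsonBox (0 : TorusSite 4 N) s p} // ¬ childrenInterior s p} → ℂ) |
      x.2 ≠ 0 ∧ ‖(wilsonCell x.1 μ 0 s).det‖ ^ 2 * ∑ q, ‖x.2 q‖ ^ 2 <
        τ ^ 2 * ∑ q, ‖(((wilsonCell x.1 μ 0 s).adjugate.toBlock (fun p => ¬ childrenInterior s p)
          (fun p => ¬ childrenInterior s p)) *ᵥ x.2) q‖ ^ 2} := by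
  have hM : Continuous fun x : GaugeConfig 4 N 𝔾 ×
      ({p : {p // wilsonBox (0 : TorusSite 4 N) s p} // ¬ childrenInterior s p} → ℂ) => wilsonCell x.1 μ 0 s :=
    (Summit.QuantumFields.QCD.Cruxes.CoerciveSea.ChiralityCollapsesPseudospectrum.CensusDominates.continuous_wilsonCell
      μ 0 s).comp continuous_fst
  have hadj : Continuous fun x : GaugeConfig 4 N 𝔾 ×
      ({p : {p // wilsonBox (0 : TorusSite 4 N) s p} // ¬ childrenInterior s p} → ℂ) =>
      (wilsonCell x.1 μ 0 s).adjugate.toBlock (fun p => ¬ childrenInterior s p) (fun p => ¬ childrenInterior s p) := by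
    refine continuous_pi fun i => continuous_pi fun j => ?_
    simp only [Matrix.toBlock_apply]
    exact hM.matrix_adjugate.matrix_elem _ _
  have hv : ∀ q : {p : {p // wilsonBox (0 : TorusSite 4 N) s p} // ¬ childrenInterior s p},
      Continuous fun x : GaugeConfig 4 N 𝔾 ×
        ({p : {p // wilsonBox (0 : TorusSite 4 N) s p} // ¬ childrenInterior s p} → ℂ) => x.2 q :=
    fun q => (continuous_apply q).comp continuous_snd
  have hf : Continuous fun x : GaugeConfig 4 N 𝔾 ×
      ({p : {p // wilsonBox (0 : TorusSite 4 N) s p} // ¬ childrenInterior s p} → ℂ) =>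
      ‖(wilsonCell x.1 μ 0 s).det‖ ^ 2 * ∑ q, ‖x.2 q‖ ^ 2 :=
    (hM.matrix_det.norm.pow 2).mul (continuous_finsetSum _ fun q _ => (hv q).norm.pow 2)
  have hmv : Continuous fun x : GaugeConfig 4 N 𝔾 ×
      ({p : {p // wilsonBox (0 : TorusSite 4 N) s p} // ¬ childrenInterior s p} → ℂ) =>
      ((wilsonCell x.1 μ 0 s).adjugate.toBlock (fun p => ¬ childrenInterior s p) (fun p => ¬ childrenInterior s p)) *ᵥ
        x.2 :=
    hadj.matrix_mulVec continuous_snd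
  have hg : Continuous fun x : GaugeConfig 4 N 𝔾 ×
      ({p : {p // wilsonBox (0 : TorusSite 4 N) s p} // ¬ childrenInterior s p} → ℂ) =>
      τ ^ 2 * ∑ q, ‖(((wilsonCell x.1 μ 0 s).adjugate.toBlock (fun p => ¬ childrenInterior s p)
        (fun p => ¬ childrenInterior s p)) *ᵥ x.2) q‖ ^ 2 :=
    continuous_const.mul (continuous_finsetSum _ fun q _ => ((continuous_apply q).comp hmv).norm.pow 2)
  have h1 : IsOpen {x : GaugeConfig 4 N 𝔾 ×
      ({p : {p // wilsonBox (0 : TorusSite 4 N) s p} // ¬ childrenInterior s p} → ℂ) | x.2 ≠ 0} :=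
    isOpen_ne_fun continuous_snd continuous_const
  exact h1.inter (isOpen_lt hf hg)

/-- **(1) The propagator event is measurable** (registered stub `measurableSet_compressedInverseEvent` of crux
stmt-QuantumFields-13901): for every torus, bare mass, box and level, `{U | det D_c(μ) = 0 ∨ ∃ v ≠ 0 on Σ,
‖v‖² < τ² ‖(D_c(μ)⁻¹)_ΣΣ v‖²}` is a measurable set of `SU(3)` gauge fields — the union of the closed crossing set
`{det = 0}` with the trace on the open set `{det ≠ 0}` of the open projection of the adjugate event. [folklore] -/
theorem measurableSet_compressedInverseEvent :
    ∀ (N : ℕ) [NeZero N] (μ : ℝ) (s : Fin 4 → ℕ) (τ : ℝ),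
      MeasurableSet {U : GaugeConfig 4 N (Matrix.specialUnitaryGroup (Fin 3) ℂ) | (wilsonCell U μ 0 s).det = 0 ∨ ∃ v : {p : {p // wilsonBox (0 : TorusSite 4 N) s p} // ¬ childrenInterior s p} → ℂ, v ≠ 0 ∧ ∑ q, ‖v q‖ ^ 2 < τ ^ 2 * ∑ q, ‖((wilsonCell U μ 0 s)⁻¹.toBlock (fun p => ¬ childrenInterior s p) (fun p => ¬ childrenInterior s p)).mulVec v q‖ ^ 2} := by
  intro N _ μ s τ
  -- the closed crossing set and the open adjugate projection
  set Z : Set (GaugeConfig 4 N 𝔾) := {U | (wilsonCell U μ 0 s).det = 0} with hZ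
  set A : Set (GaugeConfig 4 N 𝔾) := Prod.fst '' {x : GaugeConfig 4 N 𝔾 ×
      ({p : {p // wilsonBox (0 : TorusSite 4 N) s p} // ¬ childrenInterior s p} → ℂ) |
      x.2 ≠ 0 ∧ ‖(wilsonCell x.1 μ 0 s).det‖ ^ 2 * ∑ q, ‖x.2 q‖ ^ 2 <
        τ ^ 2 * ∑ q, ‖(((wilsonCell x.1 μ 0 s).adjugate.toBlock (fun p => ¬ childrenInterior s p)
          (fun p => ¬ childrenInterior s p)) *ᵥ x.2) q‖ ^ 2} with hA
  have hZc : IsClosed Z := isClosed_eq (continuous_det_wilsonCell μ s) continuous_const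
  have hAo : IsOpen A := isOpenMap_fst _ (isOpen_adjugateEvent μ s τ)
  have hset : {U : GaugeConfig 4 N 𝔾 | (wilsonCell U μ 0 s).det = 0 ∨ ∃ v : {p : {p // wilsonBox (0 : TorusSite 4 N) s p} // ¬ childrenInterior s p} → ℂ, v ≠ 0 ∧ ∑ q, ‖v q‖ ^ 2 < τ ^ 2 * ∑ q, ‖((wilsonCell U μ 0 s)⁻¹.toBlock (fun p => ¬ childrenInterior s p) (fun p => ¬ childrenInterior s p)).mulVec v q‖ ^ 2} =
      Z ∪ (Zᶜ ∩ A) := by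
    ext U
    rw [Set.mem_union, Set.mem_inter_iff, Set.mem_compl_iff, Set.mem_setOf_eq]
    by_cases hdet : (wilsonCell U μ 0 s).det = 0
    · exact ⟨fun _ => Or.inl hdet, fun _ => Or.inl hdet⟩
    · constructor
      · rintro (h | ⟨v, hv0, hlt⟩)
        · exact absurd h hdet
        · refine Or.inr ⟨hdet, ?_⟩
          rw [hA, Summit.QuantumFields.QCD.Cruxes.CoerciveSea.ChiralityCollapsesPseudospectrum.CensusDominates.mem_image_fst]
          exact ⟨v, hv0, (compressedInverse_lt_iff_adjugate (wilsonCell U μ 0 s)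
            (fun p => ¬ childrenInterior s p) hdet τ v).mp hlt⟩
      · rintro (h | ⟨-, hUA⟩)
        · exact absurd h hdet
        · rw [hA, Summit.QuantumFields.QCD.Cruxes.CoerciveSea.ChiralityCollapsesPseudospectrum.CensusDominates.mem_image_fst]
            at hUA
          obtain ⟨v, hv0, hlt⟩ := hUA
          exact Or.inr ⟨v, hv0, (compressedInverse_lt_iff_adjugate (wilsonCell U μ 0 s)
            (fun p => ¬ childrenInterior s p) hdet τ v).mpr hlt⟩
  rw [hset]
  exact hZc.measurableSet.union (hZc.isOpen_compl.measurableSet.inter hAo.measurableSet)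

/-! ### (2) Monotonicity of the phase-quenched ratio under a measurable cover -/

/-- **(2) Ratio monotonicity.** For a non-negative measurable integrable weight, a measurable event `F` and ANY event
`E ⊆ F` (measurable or not), the weighted ratios satisfy `P(E) ≤ P(F)` (Bochner conventions). [folklore] -/
theorem ratio_mono {Ω : Type*} [MeasurableSpace Ω] (μ : Measure Ω) (wt : Ω → ℝ)
    (hwt0 : ∀ U, 0 ≤ wt U) (hwtm : Measurable wt) (hwti : Integrable wt μ) (E F : Ω → Prop)
    (hF : MeasurableSet {U | F U}) (hEF : ∀ U, E U → F U) :
    (∫ U, (if E U then (1 : ℝ) else 0) * wt U ∂μ) / (∫ U, wt U ∂μ) ≤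
      (∫ U, (if F U then (1 : ℝ) else 0) * wt U ∂μ) / (∫ U, wt U ∂μ) := by
  have h := Summit.QuantumFields.QCD.Cruxes.CoerciveSea.ChiralityCollapsesPseudospectrum.CensusDominates.ratio_le
    μ wt hwt0 hwtm hwti E F (fun _ => False) hF (by simp) (fun U hU => Or.inl (hEF U hU))
  simpa using h

/-! ### (3) The reduction: a propagator law implies the line's open stub verbatim -/

/-- **(3) `separatorLawLarge` from a PROPAGATOR LAW.** If, along every physical-branch pinned-dilute regularisation, on
large window boxes in a sub-window, the phase-quenched probability of the propagator event
`det D_c(m_f(k)) = 0 ∨ ∃ v ≠ 0 on Σ, ‖v‖² < (t/s₀)² ‖(D_c(m_f(k))⁻¹)_ΣΣ v‖²` is `≤ C t^α` (hypothesis: the registered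
signature of `stub_separatorLawLarge` with ONLY the event replaced), then `stub_separatorLawLarge` holds verbatim
(conclusion: its registered signature). Proof: same witnesses; pointwise `HasSingularSeparator ⊆` propagator event
(`hasSingularSeparator_imp_det_eq_zero_or_compressedInverse`), measurability (1), ratio monotonicity (2). [folklore] -/
theorem separatorLawLarge_of_propagatorLaw
    (hP : ∀ (Nf : ℕ) (reg : QCDRegularisation Nf), (Nf = 2 ∨ Nf = 3) → reg.HasMassScaling → (reg.scheme 0 0 0).HasAsymptoticScaling → Filter.Tendsto reg.mcrit Filter.atTop (nhds 0) → ∀ M₀ : ℝ, 0 ≤ M₀ → ∀ b₀ : ℕ, 2 ≤ b₀ → ∀ ℓ : ℝ, 0 < ℓ → (∀ m : Fin Nf → ℝ, (∀ f, M₀ < m f) → ∃ R : ℝ, 0 < R ∧ (∀ ε : ℝ, 0 < ε → ∀ᶠ k : ℕ in Filter.atTop, ∀ S : ℕ, R ≤ reg.a k * (2 * S + 1) → let N : ℕ := 2 * S + 1; let mq : Fin Nf → ℝ := fun f => reg.mcrit k + reg.a k * m f / reg.Zm k; let wt : GaugeConfig 4 N (Matrix.specialUnitaryGroup (Fin 3)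 ℂ) → ℝ := fun U => ∏ f, ‖fermionDet (wilsonDirac (fundamentalRep (Fin 3)) U (mq f) 1)‖; let P : (GaugeConfig 4 N (Matrix.specialUnitaryGroup (Fin 3) ℂ) → Prop) → ℝ := fun E => (∫ U, (if E U then (1 : ℝ) else 0) * wt U ∂(wilsonMeasure (d := 4) (L := N) (fundamentalRep (Fin 3)) (reg.β k))) / (∫ U, wt U ∂(wilsonMeasure (d := 4) (L := N) (fundamentalRep (Fin 3)) (reg.β k))); let J : ℕ := Nat.log 2 (⌊ℓ / reg.a k⌋₊ / b₀) + 1; ∃ δ : ℕ → ℝ, ∑ j ∈ Finset.range J, δ j ≤ ε ∧ ∀ j < J, ∀ s : Fin 4 → ℕ, (∀ i, b₀ * 2 ^ j ≤ s i ∧ s i < b₀ * 2 ^ (j + 2) ∧ s i ≤ N ∧ (s i : ℝ) * reg.a k ≤ ℓ) → P (fun U => ∃ f, IsSignDefect U (mq f) j s) ≤ δ j) ∧ (∀ M : ℝ, M₀ < M → ∀ᶠ k : ℕ in Filter.atTop, ∀ S : ℕ, R ≤ reg.a k * (2 * S + 1) → let N : ℕ := 2 * S + 1; let mq : Fin Nf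 → ℝ := fun f => reg.mcrit k + reg.a k * m f / reg.Zm k; let wt : GaugeConfig 4 N (Matrix.specialUnitaryGroup (Fin 3) ℂ) → ℝ := fun U => ∏ f, ‖fermionDet (wilsonDirac (fundamentalRep (Fin 3)) U (mq f) 1)‖; (1 / 4 : ℝ) ≤ (∫ U, (if (fermionDet (wilsonDirac (fundamentalRep (Fin 3)) U (reg.mcrit k - reg.a k * M / reg.Zm k) 1)).re < 0 then (1 : ℝ) else 0) * wt U ∂(wilsonMeasure (d := 4) (L := N) (fundamentalRep (Fin 3)) (reg.β k))) / (∫ U, wt U ∂(wilsonMeasure (d := 4) (L := N) (fundamentalRep (Fin 3)) (reg.β k))))) → ∃ M₁ : ℝ, M₀ ≤ M₁ ∧ ∃ ℓ' : ℝ, 0 < ℓ' ∧ ℓ' ≤ ℓ ∧ ∀ m : Fin Nf → ℝ, (∀ f, M₁ < m f) → ∃ R : ℝ, 0 < R ∧ ∃ S₀ : ℕ, ∃ C : ℝ, 0 < C ∧ ∃ α : ℝ, 0 < α ∧ ∀ᶠ k : ℕ in Filter.atTop, ∀ S : ℕ, R ≤ reg.a k * (2 * S + 1) → let N : ℕ :=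 2 * S + 1; let mq : Fin Nf → ℝ := fun f => reg.mcrit k + reg.a k * m f / reg.Zm k; let wt : GaugeConfig 4 N (Matrix.specialUnitaryGroup (Fin 3) ℂ) → ℝ := fun U => ∏ f, ‖fermionDet (wilsonDirac (fundamentalRep (Fin 3)) U (mq f) 1)‖; let P : (GaugeConfig 4 N (Matrix.specialUnitaryGroup (Fin 3) ℂ) → Prop) → ℝ := fun E => (∫ U, (if E U then (1 : ℝ) else 0) * wt U ∂(wilsonMeasure (d := 4) (L := N) (fundamentalRep (Fin 3)) (reg.β k))) / (∫ U, wt U ∂(wilsonMeasure (d := 4) (L := N) (fundamentalRep (Fin 3)) (reg.β k))); ∀ s : Fin 4 → ℕ, (∀ i, b₀ ≤ s i ∧ s i ≤ N ∧ (s i : ℝ) * reg.a k ≤ ℓ') → (∀ i, S₀ ≤ s i) → (∀ i j, s i ≤ 2 * s j) → ∀ f : Fin Nf, ∀ t : ℝ, 0 < t → t ≤ 1 → P (fun U => (wilsonCell U (mq f) 0 s).det = 0 ∨ ∃ v : {p : {p // wilsonBox (0 : TorusSite 4 N) s p} // ¬ childrenInterior s p} → ℂ, v ≠ 0 ∧ ∑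 q, ‖v q‖ ^ 2 < (t / s 0) ^ 2 * ∑ q, ‖((wilsonCell U (mq f) 0 s)⁻¹.toBlock (fun p => ¬ childrenInterior s p) (fun p => ¬ childrenInterior s p)).mulVec v q‖ ^ 2) ≤ C * t ^ α) :
    ∀ (Nf : ℕ) (reg : QCDRegularisation Nf), (Nf = 2 ∨ Nf = 3) → reg.HasMassScaling → (reg.scheme 0 0 0).HasAsymptoticScaling → Filter.Tendsto reg.mcrit Filter.atTop (nhds 0) → ∀ M₀ : ℝ, 0 ≤ M₀ → ∀ b₀ : ℕ, 2 ≤ b₀ → ∀ ℓ : ℝ, 0 < ℓ → (∀ m : Fin Nf → ℝ, (∀ f, M₀ < m f) → ∃ R : ℝ, 0 < R ∧ (∀ ε : ℝ, 0 < ε → ∀ᶠ k : ℕ in Filter.atTop, ∀ S : ℕ, R ≤ reg.a k * (2 * S + 1) → let N : ℕ := 2 * S + 1; let mq : Fin Nf → ℝ := fun f => reg.mcrit k + reg.a k * m f / reg.Zm k; let wt : GaugeConfig 4 N (Matrix.specialUnitaryGroup (Fin 3) ℂ) → ℝ := fun U => ∏ f, ‖fermionDet (wilsonDirac (fundamentalRep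 (Fin 3)) U (mq f) 1)‖; let P : (GaugeConfig 4 N (Matrix.specialUnitaryGroup (Fin 3) ℂ) → Prop) → ℝ := fun E => (∫ U, (if E U then (1 : ℝ) else 0) * wt U ∂(wilsonMeasure (d := 4) (L := N) (fundamentalRep (Fin 3)) (reg.β k))) / (∫ U, wt U ∂(wilsonMeasure (d := 4) (L := N) (fundamentalRep (Fin 3)) (reg.β k))); let J : ℕ := Nat.log 2 (⌊ℓ / reg.a k⌋₊ / b₀) + 1; ∃ δ : ℕ → ℝ, ∑ j ∈ Finset.range J, δ j ≤ ε ∧ ∀ j < J, ∀ s : Fin 4 → ℕ, (∀ i, b₀ * 2 ^ j ≤ s i ∧ s i < b₀ * 2 ^ (j + 2) ∧ s i ≤ N ∧ (s i : ℝ) * reg.a k ≤ ℓ) → P (fun U => ∃ f, IsSignDefect U (mq f) j s) ≤ δ j) ∧ (∀ M : ℝ, M₀ < M → ∀ᶠ k : ℕ in Filter.atTop, ∀ S : ℕ, R ≤ reg.a k * (2 * S + 1) → let N : ℕ := 2 * S + 1; let mq : Fin Nf → ℝ := fun f => reg.mcrit k + reg.a k * m f / reg.Zm k; let wt : GaugeConfig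 4 N (Matrix.specialUnitaryGroup (Fin 3) ℂ) → ℝ := fun U => ∏ f, ‖fermionDet (wilsonDirac (fundamentalRep (Fin 3)) U (mq f) 1)‖; (1 / 4 : ℝ) ≤ (∫ U, (if (fermionDet (wilsonDirac (fundamentalRep (Fin 3)) U (reg.mcrit k - reg.a k * M / reg.Zm k) 1)).re < 0 then (1 : ℝ) else 0) * wt U ∂(wilsonMeasure (d := 4) (L := N) (fundamentalRep (Fin 3)) (reg.β k))) / (∫ U, wt U ∂(wilsonMeasure (d := 4) (L := N) (fundamentalRep (Fin 3)) (reg.β k))))) → ∃ M₁ : ℝ, M₀ ≤ M₁ ∧ ∃ ℓ' : ℝ, 0 < ℓ' ∧ ℓ' ≤ ℓ ∧ ∀ m : Fin Nf → ℝ, (∀ f, M₁ < m f) → ∃ R : ℝ, 0 < R ∧ ∃ S₀ : ℕ, ∃ C : ℝ, 0 < C ∧ ∃ α : ℝ, 0 < α ∧ ∀ᶠ k : ℕ in Filter.atTop, ∀ S : ℕ, R ≤ reg.a k * (2 * S + 1) → let N : ℕ := 2 * S + 1; let mq : Fin Nf → ℝ := fun f => reg.mcrit k + reg.a k * m f / reg.Zm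 k; let wt : GaugeConfig 4 N (Matrix.specialUnitaryGroup (Fin 3) ℂ) → ℝ := fun U => ∏ f, ‖fermionDet (wilsonDirac (fundamentalRep (Fin 3)) U (mq f) 1)‖; let P : (GaugeConfig 4 N (Matrix.specialUnitaryGroup (Fin 3) ℂ) → Prop) → ℝ := fun E => (∫ U, (if E U then (1 : ℝ) else 0) * wt U ∂(wilsonMeasure (d := 4) (L := N) (fundamentalRep (Fin 3)) (reg.β k))) / (∫ U, wt U ∂(wilsonMeasure (d := 4) (L := N) (fundamentalRep (Fin 3)) (reg.β k))); ∀ s : Fin 4 → ℕ, (∀ i, b₀ ≤ s i ∧ s i ≤ N ∧ (s i : ℝ) * reg.a k ≤ ℓ') → (∀ i, S₀ ≤ s i) → (∀ i j, s i ≤ 2 * s j) → ∀ f : Fin Nf, ∀ t : ℝ, 0 < t → t ≤ 1 → P (fun U => HasSingularSeparator U (mq f) s (t / s 0)) ≤ C * t ^ α := by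
  intro Nf reg hNf hms has hcrit M₀ hM₀ b₀ hb₀ ℓ hℓ hm
  obtain ⟨M₁, hM₁, ℓ', hℓ'0, hℓ'ℓ, hLaw⟩ := hP Nf reg hNf hms has hcrit M₀ hM₀ b₀ hb₀ ℓ hℓ hm
  refine ⟨M₁, hM₁, ℓ', hℓ'0, hℓ'ℓ, fun m hmm => ?_⟩
  obtain ⟨R, hR, S₀, C, hC, α, hα, hk⟩ := hLaw m hmm
  refine ⟨R, hR, S₀, C, hC, α, hα, ?_⟩
  filter_upwards [hk] with k hk S hS
  have hk' := hk S hS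
  dsimp only at hk' ⊢
  intro s hs hS₀ hcub f t ht0 ht1
  refine le_trans ?_ (hk' s hs hS₀ hcub f t ht0 ht1)
  have hwt0 : ∀ U : GaugeConfig 4 (2 * S + 1) 𝔾,
      0 ≤ ∏ f', ‖fermionDet (wilsonDirac (fundamentalRep (Fin 3)) U (reg.mcrit k + reg.a k * m f' / reg.Zm k) 1)‖ :=
    fun U => Finset.prod_nonneg fun f' _ => norm_nonneg _
  have hwtm : Measurable fun U : GaugeConfig 4 (2 * S + 1) 𝔾 =>
      ∏ f', ‖fermionDet (wilsonDirac (fundamentalRep (Fin 3)) U (reg.mcrit k + reg.a k * m f' / reg.Zm k) 1)‖ := by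
    simpa only [norm_det_diracMatrix] using
      measurable_norm_det_diracMatrix (S := 2 * S + 1) (fun f' => reg.mcrit k + reg.a k * m f' / reg.Zm k)
  have hwti : Integrable (fun U : GaugeConfig 4 (2 * S + 1) 𝔾 =>
      ∏ f', ‖fermionDet (wilsonDirac (fundamentalRep (Fin 3)) U (reg.mcrit k + reg.a k * m f' / reg.Zm k) 1)‖)
      (wilsonMeasure (d := 4) (L := 2 * S + 1) (fundamentalRep (Fin 3)) (reg.β k)) := by
    simpa only [norm_det_diracMatrix] using
      integrable_norm_det_diracMatrix (S := 2 * S + 1) (fun f' => reg.mcrit k + reg.a k * m f' / reg.Zm k)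
        (wilsonMeasure (d := 4) (L := 2 * S + 1) (fundamentalRep (Fin 3)) (reg.β k))
  exact ratio_mono _ _ hwt0 hwtm hwti _ _
    (measurableSet_compressedInverseEvent (2 * S + 1) (reg.mcrit k + reg.a k * m f / reg.Zm k) s (t / s 0))
    (fun U hU => hasSingularSeparator_imp_det_eq_zero_or_compressedInverse U _ s _ hU)

end Summit.QuantumFields.QCD.Theorems.NestedDissectionSeaCoerciveSea

end
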